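import Mathlib

/-!
# Wall bubbling for `DoorA26` — (W) chain piece at a Weyl TRIPLE: THE MOMENT TAIL OF A MERGING CLASS (member-count recurrence, gap-free)

HONEST FRAMING.  Chain lemma toward `TripleStratum26` of `Cruxes/DoorA26/Lines/wall_bubbling_ConfluentDoor.lean` (rev 13; crux `DoorA26`,
stmt-ValiantsHypothesis-19979 — OPEN, typed, never asserted), the one hypothesis of the (W) ledger «(W) ⟸ ConfluentDoor26 ∧ NoTightChain26NC ∧ (M) ∧
TripleStratum26» nobody had touched.  W1 seat val-sym-door-p2 g15.  At a Weyl triple the Gram-normalised Newton frame has a REALISABLE degenerate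
direction (W1 #80 `…TripleNullVariety`), so the cluster limit must be taken at FUNCTION level, class by class, in the MOMENT currency of W2's
`…ClassMoments` / `…ClassTower` (door-p1 g13): inside one merging value class with member deviations `ε_i` (`|ε_i| ≤ w`) and coefficients `a_i`
the moments `M_m = Σ_i a_i ε_i^m`, `m < n` (`n` = number of members), are the limit slot coefficients.  W2's `classTower_limit` controls the tail by
`(Σ_i |a_i|)·w^n` and `levelSelection_class` feeds that from a VANDERMONDE hypothesis — which FAILS for the six members `ε_p + ε_q` of the class `2α`
of a triple when two of the three exponents sub-cluster (coefficients blow up at the inner scale).  This file is the gap-free replacement: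

* `moment_twist` — twisting the coefficients at a member, `a_i ↦ a_i (ε_i − ε_{i₀})`, drops that member and shifts the moments:
  `Σ_{i ≠ i₀} a_i(ε_i − ε_{i₀}) ε_i^m = M_{m+1} − ε_{i₀} M_m`;
* **`momentTail`** — for every `K` there is `C ≥ 0` such that for every member set of size `≤ K` with `|ε_i| ≤ w ≤ 1/2`:
  `|M_m| ≤ C · w · Σ_{j<K} |M_j|` for all `m ≥ K` (induction on the member set by twisting; no gap / Vandermonde hypothesis, coefficients arbitrary);
* `momentTail_le` — the bounded form `|M_m| ≤ max 1 C · Σ_{j<K} |M_j|` for ALL `m`.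

These feed the moment-tail hypothesis of the class tower limit (next file `…MomentTower`).  No definitions; nothing here bears on `DoorA26`,
`MatrixDescartes` (stmt-ValiantsHypothesis-18050) or `VP ≠ VNP`; `TripleStratum26`, (W), (M) OPEN.

[folklore] Linear recurrence of power sums (Newton); elementary estimates.  [this work] the twisting induction.
-/

-- `Summit.ValiantsHypothesis.ValiantsHypothesis.…` repeats a component by the D-0017 layout
-- (single-conjunct summit), which the `dupNamespace` linter flags; the name is mandated.
set_option linter.dupNamespace false

namespace Summit.ValiantsHypothesis.ValiantsHypothesis.Theorems.LacunarySymmetroidMatrixDescartes.WallBubbling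

open Finset
open scoped BigOperators

/-- **Twisting at a member.**  `Σ_{i ∈ s ∖ {i₀}} a_i (ε_i − ε_{i₀}) ε_i^m = M_{m+1} − ε_{i₀}·M_m`. [folklore] -/
theorem moment_twist {ι : Type*} [DecidableEq ι] (s : Finset ι) {i₀ : ι} (hi₀ : i₀ ∈ s) (a ε : ι → ℝ) (m : ℕ) :
    ∑ i ∈ s.erase i₀, a i * (ε i - ε i₀) * ε i ^ m
      = ∑ i ∈ s, a i * ε i ^ (m + 1) - ε i₀ * ∑ i ∈ s, a i * ε i ^ m := by
  rw [Finset.mul_sum, ← Finset.sum_sub_distrib, ← Finset.sum_erase_add _ _ hi₀]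
  have h0 : a i₀ * ε i₀ ^ (m + 1) - ε i₀ * (a i₀ * ε i₀ ^ m) = 0 := by ring
  rw [h0, add_zero]
  exact Finset.sum_congr rfl fun i _ => by ring

/-- **THE MOMENT TAIL OF A MERGING CLASS.**  For every `K` there is a constant `C ≥ 0` such that for every member set `s` with at most `K`
members, all coefficients `a`, all deviations `|ε_i| ≤ w ≤ 1/2` (`i ∈ s`) and every `m ≥ K`:
`|Σ_{i∈s} a_i ε_i^m| ≤ C · w · Σ_{j<K} |Σ_{i∈s} a_i ε_i^j|`. [this work] -/
theorem momentTail (K : ℕ) : ∃ C : ℝ, 0 ≤ C ∧ ∀ {ι : Type*} [DecidableEq ι] (s : Finset ι), s.card ≤ K →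
    ∀ (a ε : ι → ℝ) (w : ℝ), 0 ≤ w → w ≤ 1 / 2 → (∀ i ∈ s, |ε i| ≤ w) →
    ∀ m, K ≤ m → |∑ i ∈ s, a i * ε i ^ m| ≤ C * w * ∑ j ∈ Finset.range K, |∑ i ∈ s, a i * ε i ^ j| := by
  induction K with
  | zero =>
    refine ⟨0, le_rfl, ?_⟩
    intro ι _ s hs a ε w _ _ _ m _
    have hs0 : s = ∅ := Finset.card_eq_zero.mp (Nat.le_zero.mp hs)
    simp [hs0]
  | succ K ih =>
    obtain ⟨C, hC0, hC⟩ := ih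
    refine ⟨(2 * C + max 1 (2 * C)) * 2, by positivity, ?_⟩
    intro ι _ s hs a ε w hw0 hw1 hε m hm
    -- the moments and the head sum
    set M : ℕ → ℝ := fun j => ∑ i ∈ s, a i * ε i ^ j with hM
    set S : ℝ := ∑ j ∈ Finset.range (K + 1), |M j| with hS
    have hS0 : 0 ≤ S := Finset.sum_nonneg fun j _ => abs_nonneg _
    change |M m| ≤ (2 * C + max 1 (2 * C)) * 2 * w * S
    by_cases hse : s = ∅
    · have hMz : ∀ j, M j = 0 := fun j => by simp [hM, hse]
      rw [hMz, abs_zero]; positivity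
    obtain ⟨i₀, hi₀⟩ := Finset.nonempty_iff_ne_empty.mpr hse
    -- the twisted family on `s ∖ {i₀}`
    set M' : ℕ → ℝ := fun j => ∑ i ∈ s.erase i₀, (a i * (ε i - ε i₀)) * ε i ^ j with hM'
    have htw : ∀ j, M' j = M (j + 1) - ε i₀ * M j := fun j => moment_twist s hi₀ a ε j
    have hcard : (s.erase i₀).card ≤ K := by rw [Finset.card_erase_of_mem hi₀]; omega
    have hε' : ∀ i ∈ s.erase i₀, |ε i| ≤ w := fun i hi => hε i (Finset.mem_of_mem_erase hi)
    have hIH : ∀ m, K ≤ m → |M' m| ≤ C * w * ∑ j ∈ Finset.range K, |M' j| :=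
      hC (s.erase i₀) hcard (fun i => a i * (ε i - ε i₀)) ε w hw0 hw1 hε'
    have hεi₀ : |ε i₀| ≤ w := hε i₀ hi₀
    have hw1' : w ≤ 1 := by linarith
    -- the twisted head sum is at most `2 S`
    have hS' : ∑ j ∈ Finset.range K, |M' j| ≤ 2 * S := by
      have h1 : ∀ j ∈ Finset.range K, |M' j| ≤ |M (j + 1)| + |M j| := by
        intro j _
        rw [htw]
        calc |M (j + 1) - ε i₀ * M j| ≤ |M (j + 1)| + |ε i₀ * M j| := abs_sub _ _
          _ = |M (j + 1)| + |ε i₀| * |M j| := by rw [abs_mul]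
          _ ≤ |M (j + 1)| + 1 * |M j| := by gcongr; exact hεi₀.trans hw1'
          _ = |M (j + 1)| + |M j| := by rw [one_mul]
      calc ∑ j ∈ Finset.range K, |M' j| ≤ ∑ j ∈ Finset.range K, (|M (j + 1)| + |M j|) := Finset.sum_le_sum h1
        _ = ∑ j ∈ Finset.range K, |M (j + 1)| + ∑ j ∈ Finset.range K, |M j| := Finset.sum_add_distrib
        _ ≤ S + S := by
            apply add_le_add
            · rw [hS, Finset.sum_range_succ']
              exact le_add_of_nonneg_right (abs_nonneg _)
            · rw [hS, Finset.sum_range_succ]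
              exact le_add_of_nonneg_right (abs_nonneg _)
        _ = 2 * S := by ring
    -- one step of the recurrence: `|M (j+1)| ≤ 2 C w S + w |M j|` for `j ≥ K`
    have hstep : ∀ j, K ≤ j → |M (j + 1)| ≤ 2 * C * w * S + w * |M j| := by
      intro j hj
      have e1 : M (j + 1) = M' j + ε i₀ * M j := by rw [htw]; ring
      rw [e1]
      calc |M' j + ε i₀ * M j| ≤ |M' j| + |ε i₀ * M j| := abs_add_le _ _
        _ = |M' j| + |ε i₀| * |M j| := by rw [abs_mul]
        _ ≤ C * w * ∑ j ∈ Finset.range K, |M' j| + w * |M j| := by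
            gcongr
            exact hIH j hj
        _ ≤ C * w * (2 * S) + w * |M j| := by gcongr
        _ = 2 * C * w * S + w * |M j| := by ring
    -- boundedness of all moments from `K` on
    have hbd : ∀ n, |M (K + n)| ≤ max 1 (2 * C) * S := by
      intro n
      induction n with
      | zero =>
        calc |M (K + 0)| = |M K| := by rw [add_zero]
          _ ≤ S := by
              rw [hS]
              exact Finset.single_le_sum (f := fun j => |M j|) (fun _ _ => abs_nonneg _)
                (Finset.mem_range.mpr (Nat.lt_succ_self K))
          _ = 1 * S := (one_mul S).symm
          _ ≤ max 1 (2 * C) * S := by gcongr; exact le_max_left _ _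
      | succ n ihn =>
        have hle1 : (1 : ℝ) ≤ max 1 (2 * C) := le_max_left _ _
        have hle2 : 2 * C ≤ max 1 (2 * C) := le_max_right _ _
        calc |M (K + (n + 1))| = |M (K + n + 1)| := by rw [add_assoc]
          _ ≤ 2 * C * w * S + w * |M (K + n)| := hstep (K + n) (Nat.le_add_right K n)
          _ ≤ 2 * C * w * S + w * (max 1 (2 * C) * S) := by gcongr
          _ = w * ((2 * C + max 1 (2 * C)) * S) := by ring
          _ ≤ (1 / 2) * ((2 * C + max 1 (2 * C)) * S) := by gcongr
          _ ≤ max 1 (2 * C) * S := by nlinarith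
    -- the tail bound for `m ≥ K + 1`
    obtain ⟨n, rfl⟩ : ∃ n, m = K + n + 1 := ⟨m - K - 1, by omega⟩
    calc |M (K + n + 1)| ≤ 2 * C * w * S + w * |M (K + n)| := hstep (K + n) (Nat.le_add_right K n)
      _ ≤ 2 * C * w * S + w * (max 1 (2 * C) * S) := by gcongr; exact hbd n
      _ = (2 * C + max 1 (2 * C)) * w * S := by ring
      _ ≤ (2 * C + max 1 (2 * C)) * 2 * w * S := by
          have : 0 ≤ (2 * C + max 1 (2 * C)) * w * S := by positivity
          nlinarith

/-- **Bounded form.**  With the constant `C` of `momentTail K`: EVERY moment is at most `max 1 C` times the head sum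
(`m < K` trivially, `m ≥ K` by the tail bound and `w ≤ 1/2`). [this work] -/
theorem momentTail_le (K : ℕ) : ∃ C : ℝ, 0 ≤ C ∧ ∀ {ι : Type*} [DecidableEq ι] (s : Finset ι), s.card ≤ K →
    ∀ (a ε : ι → ℝ) (w : ℝ), 0 ≤ w → w ≤ 1 / 2 → (∀ i ∈ s, |ε i| ≤ w) →
    (∀ m, K ≤ m → |∑ i ∈ s, a i * ε i ^ m| ≤ C * w * ∑ j ∈ Finset.range K, |∑ i ∈ s, a i * ε i ^ j|) ∧
    (∀ m, |∑ i ∈ s, a i * ε i ^ m| ≤ max 1 C * ∑ j ∈ Finset.range K, |∑ i ∈ s, a i * ε i ^ j|) := by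
  obtain ⟨C, hC0, hC⟩ := momentTail K
  refine ⟨C, hC0, fun s hs a ε w hw0 hw1 hε => ⟨hC s hs a ε w hw0 hw1 hε, fun m => ?_⟩⟩
  have hS0 : 0 ≤ ∑ j ∈ Finset.range K, |∑ i ∈ s, a i * ε i ^ j| := Finset.sum_nonneg fun j _ => abs_nonneg _
  by_cases hm : K ≤ m
  · calc |∑ i ∈ s, a i * ε i ^ m| ≤ C * w * ∑ j ∈ Finset.range K, |∑ i ∈ s, a i * ε i ^ j| := hC s hs a ε w hw0 hw1 hε m hm
      _ ≤ C * 1 * ∑ j ∈ Finset.range K, |∑ i ∈ s, a i * ε i ^ j| := by gcongr; linarith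
      _ ≤ max 1 C * ∑ j ∈ Finset.range K, |∑ i ∈ s, a i * ε i ^ j| := by
          rw [mul_one]; gcongr; exact le_max_right _ _
  · push Not at hm
    calc |∑ i ∈ s, a i * ε i ^ m| ≤ ∑ j ∈ Finset.range K, |∑ i ∈ s, a i * ε i ^ j| :=
          Finset.single_le_sum (f := fun j => |∑ i ∈ s, a i * ε i ^ j|) (fun _ _ => abs_nonneg _) (Finset.mem_range.mpr hm)
      _ = 1 * _ := (one_mul _).symm
      _ ≤ max 1 C * ∑ j ∈ Finset.range K, |∑ i ∈ s, a i * ε i ^ j| := by gcongr; exact le_max_left _ _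

end Summit.ValiantsHypothesis.ValiantsHypothesis.Theorems.LacunarySymmetroidMatrixDescartes.WallBubbling
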